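import Summits.AtomisticToContinuum.FouriersLaw.Theorems.BondHeatUncertaintySubdiffusiveBondHeatJunctionRatioFirstBondBracket

/-!
# `JunctionRatioTemperedPairing` — file 23a of the junction-ratio programme: Gibbs integration by
# parts on the TEMPERED class

Route `BondHeatUncertainty`, residual `BoundedResponse` (stmt-AtomisticToContinuum-11071), leaf [BI]
`EscapeGrading.FirstBondBracket` (file 19b), g64 weak-form skeleton: the pieces **[GIBBS]** (the
equilibrium identity `(G1)`), the Gibbs half of **[WL]** (`∫ ∂²_{p_b}F dμ_T = ⟨F, p_b²/T² - 1/T⟩`) and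
**[EXT]** all reduce to ONE PAIRING RULE for `P = pinnedChain ω₂ lam β γ` (`ω₂ > 0`, `lam, β ≥ 0`,
`T > 0`, `ρ_T = e^{-H/T}`): if `∂_v H = D` then `∫ D · F · ρ_T = T · ∫ (∂_v F) · ρ_T`
(`integral_lineDeriv_hamiltonian_mul_gibbsDensity_eq`), with the instances
(IBP-p) `∫ p_k F ρ_T = T ∫ ∂_{p_k}F ρ_T` and (IBP-q) `∫ ∂_{q_k}H F ρ_T = T ∫ ∂_{q_k}F ρ_T`, for every
line-differentiable `F` with `F` and its derivative continuous and TEMPERED, `|F| ≤ C (1 + H)^m`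
(`IsTempered`; no compact support or decay of derivatives is assumed). Tools: the tree's
`SubdiffusiveBondHeat.integral_mul_eq_neg_of_hasLineDerivAt_of_integrable`,
`OscillatorChain.hasLineDerivAt_gibbsDensity`, `LightConeBondHeat.pinnedChain_integrable_mul_gibbsDensity_of_le_pow`.
§A the tempered class and its algebra; §B the rule and (IBP-p)/(IBP-q); §C `C¹` and Gibbs-MEASURE
forms; §D observables independent of `p_k` (`∫ p_k F ρ_T = 0`, `∫ p_k² F ρ_T = T ∫ F ρ_T`,
`∫ p_b p_j ρ_T = 0`) and the bath identity `T² ∫ ∂²_{p_k}F ρ_T = ∫ p_k² F ρ_T - T ∫ F ρ_T`.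
One definition (`IsTempered`, a `Prop`, same advisory class as 19a's notions); all theorems fully
proved; imports file 19b only.
-/

noncomputable section

open MeasureTheory Filter Topology Set
open scoped BigOperators ContDiff

namespace Summit.AtomisticToContinuum.FouriersLaw.Theorems.SubdiffusiveBondHeat

namespace EscapeGrading

open Literature.MathematicalPhysics.KineticTheory.HeatConduction
open Summit.AtomisticToContinuum.FouriersLaw.Theorems.LightConeBondHeat
  (pinnedChain_integrable_mul_gibbsDensity_of_le_pow pinnedChain_abs_partialQ_le)

variable {N : ℕ} {ω₂ lam β γ : ℝ}

/-! ## A. The tempered class -/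

/-- `F : PhaseSpace N → ℝ` is TEMPERED for `pinnedChain ω₂ lam β γ`: `|F| ≤ C (1 + H)^m`. Continuous
tempered functions are integrable against `e^{-H/T}`; the class is an algebra containing `q_k, p_k, ∂_{q_k}H`. -/
def IsTempered (ω₂ lam β γ : ℝ) (N : ℕ) (F : PhaseSpace N → ℝ) : Prop :=
  ∃ C : ℝ, ∃ m : ℕ, ∀ x, |F x| ≤ C * (1 + (pinnedChain ω₂ lam β γ).hamiltonian N x) ^ m

namespace IsTempered

variable {F G : PhaseSpace N → ℝ}

/-- Domination: `|F| ≤ |G|` with `G` tempered. -/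
theorem of_abs_le (hG : IsTempered ω₂ lam β γ N G) (h : ∀ x, |F x| ≤ |G x|) :
    IsTempered ω₂ lam β γ N F := by
  obtain ⟨C, m, hC⟩ := hG
  exact ⟨C, m, fun x => (h x).trans (hC x)⟩

/-- Bounded functions are tempered (`m = 0`). -/
theorem of_bounded {C : ℝ} (h : ∀ x, |F x| ≤ C) : IsTempered ω₂ lam β γ N F :=
  ⟨C, 0, fun x => by rw [pow_zero, mul_one]; exact h x⟩

/-- Constants are tempered. -/
theorem const (c : ℝ) : IsTempered ω₂ lam β γ N fun _ => c :=
  of_bounded fun _ => le_rfl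

/-- Products of tempered functions are tempered. -/
theorem mul (hF : IsTempered ω₂ lam β γ N F) (hG : IsTempered ω₂ lam β γ N G) :
    IsTempered ω₂ lam β γ N fun x => F x * G x := by
  obtain ⟨C₁, m₁, h₁⟩ := hF
  obtain ⟨C₂, m₂, h₂⟩ := hG
  refine ⟨C₁ * C₂, m₁ + m₂, fun x => ?_⟩
  rw [abs_mul, pow_add]
  calc |F x| * |G x|
      ≤ C₁ * (1 + (pinnedChain ω₂ lam β γ).hamiltonian N x) ^ m₁ *
          (C₂ * (1 + (pinnedChain ω₂ lam β γ).hamiltonian N x) ^ m₂) :=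
        mul_le_mul (h₁ x) (h₂ x) (abs_nonneg _) ((abs_nonneg _).trans (h₁ x))
    _ = C₁ * C₂ * ((1 + (pinnedChain ω₂ lam β γ).hamiltonian N x) ^ m₁ *
          (1 + (pinnedChain ω₂ lam β γ).hamiltonian N x) ^ m₂) := by ring

/-- Scalar multiples of tempered functions are tempered. -/
theorem const_mul (hF : IsTempered ω₂ lam β γ N F) (c : ℝ) :
    IsTempered ω₂ lam β γ N fun x => c * F x :=
  (const c).mul hF

/-- Negatives of tempered functions are tempered. -/
theorem neg (hF : IsTempered ω₂ lam β γ N F) : IsTempered ω₂ lam β γ N fun x => -F x :=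
  hF.of_abs_le fun x => by rw [abs_neg]

/-- Powers of tempered functions are tempered. -/
theorem pow (hF : IsTempered ω₂ lam β γ N F) (n : ℕ) :
    IsTempered ω₂ lam β γ N fun x => F x ^ n := by
  obtain ⟨C, m, h⟩ := hF
  refine ⟨C ^ n, m * n, fun x => ?_⟩
  rw [abs_pow, pow_mul, ← mul_pow]
  exact pow_le_pow_left₀ (abs_nonneg _) (h x) n

/-- Sums of tempered functions are tempered (uses `H ≥ 0`, i.e. `ω₂, lam, β ≥ 0`). -/
theorem add (hω : 0 ≤ ω₂) (hl : 0 ≤ lam) (hβ : 0 ≤ β) (hF : IsTempered ω₂ lam β γ N F)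
    (hG : IsTempered ω₂ lam β γ N G) : IsTempered ω₂ lam β γ N fun x => F x + G x := by
  obtain ⟨C₁, m₁, h₁⟩ := hF
  obtain ⟨C₂, m₂, h₂⟩ := hG
  refine ⟨|C₁| + |C₂|, m₁ + m₂, fun x => ?_⟩
  have h1x := h₁ x; have h2x := h₂ x
  have hb : (1 : ℝ) ≤ 1 + (pinnedChain ω₂ lam β γ).hamiltonian N x :=
    le_add_of_nonneg_right (pinnedChain_hamiltonian_nonneg hω hl hβ γ N x)
  have h0 : (0 : ℝ) ≤ 1 + (pinnedChain ω₂ lam β γ).hamiltonian N x := zero_le_one.trans hb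
  rw [pow_add]
  calc |F x + G x| ≤ |F x| + |G x| := abs_add_le _ _
    _ ≤ |C₁| * (1 + (pinnedChain ω₂ lam β γ).hamiltonian N x) ^ m₁ +
          |C₂| * (1 + (pinnedChain ω₂ lam β γ).hamiltonian N x) ^ m₂ :=
        add_le_add (h1x.trans (mul_le_mul_of_nonneg_right (le_abs_self _) (pow_nonneg h0 _)))
          (h2x.trans (mul_le_mul_of_nonneg_right (le_abs_self _) (pow_nonneg h0 _)))
    _ ≤ |C₁| * (1 + (pinnedChain ω₂ lam β γ).hamiltonian N x) ^ m₁ *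
            (1 + (pinnedChain ω₂ lam β γ).hamiltonian N x) ^ m₂ +
          |C₂| * (1 + (pinnedChain ω₂ lam β γ).hamiltonian N x) ^ m₂ *
            (1 + (pinnedChain ω₂ lam β γ).hamiltonian N x) ^ m₁ :=
        add_le_add
          (le_mul_of_one_le_right (mul_nonneg (abs_nonneg _) (pow_nonneg h0 _)) (one_le_pow₀ hb))
          (le_mul_of_one_le_right (mul_nonneg (abs_nonneg _) (pow_nonneg h0 _)) (one_le_pow₀ hb))
    _ = (|C₁| + |C₂|) * ((1 + (pinnedChain ω₂ lam β γ).hamiltonian N x) ^ m₁ *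
          (1 + (pinnedChain ω₂ lam β γ).hamiltonian N x) ^ m₂) := by ring

/-- Differences of tempered functions are tempered. -/
theorem sub (hω : 0 ≤ ω₂) (hl : 0 ≤ lam) (hβ : 0 ≤ β) (hF : IsTempered ω₂ lam β γ N F)
    (hG : IsTempered ω₂ lam β γ N G) : IsTempered ω₂ lam β γ N fun x => F x - G x := by
  simpa only [sub_eq_add_neg] using hF.add hω hl hβ hG.neg

/-- The momenta are tempered: `|p_k| ≤ 4(1+H)²` (`SubdiffusiveBondHeat.pinnedChain_abs_momentum_pow_le`). -/
theorem snd (hω : 0 ≤ ω₂) (hl : 0 ≤ lam) (hβ : 0 ≤ β) (k : Fin N) :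
    IsTempered ω₂ lam β γ N fun x => x.2 k :=
  ⟨4, 2, fun x => by
    simpa only [pow_one] using
      pinnedChain_abs_momentum_pow_le hω hl hβ γ N x k (k := 1) (by norm_num)⟩

/-- The positions are tempered (`ω₂ > 0`: `ω₂ q_k²/2 ≤ H` and `|q| ≤ 1/2 + q²/2`). -/
theorem fst (hω : 0 < ω₂) (hl : 0 ≤ lam) (hβ : 0 ≤ β) (k : Fin N) :
    IsTempered ω₂ lam β γ N fun x => x.1 k := by
  refine ⟨1 + 1 / ω₂, 1, fun x => ?_⟩
  have h := pinnedChain_harmonic_le_hamiltonian (ω₂ := ω₂) hl hβ γ N x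
  have h1 : ω₂ * x.1 k ^ 2 / 2 ≤ ∑ i, ω₂ * x.1 i ^ 2 / 2 :=
    Finset.single_le_sum (f := fun i => ω₂ * x.1 i ^ 2 / 2) (fun i _ => by positivity)
      (Finset.mem_univ k)
  have h2 : 0 ≤ ∑ i, x.2 i ^ 2 / 2 := Finset.sum_nonneg fun i _ => by positivity
  have h3 := abs_le_half_add_sq_half (x.1 k); have hH := pinnedChain_hamiltonian_nonneg hω.le hl hβ γ N x
  have hq : x.1 k ^ 2 / 2 ≤ 1 / ω₂ * (pinnedChain ω₂ lam β γ).hamiltonian N x := by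
    rw [one_div, ← div_eq_inv_mul, le_div_iff₀ hω]
    linarith
  have h0 : 0 ≤ 1 / ω₂ := by positivity
  show |x.1 k| ≤ (1 + 1 / ω₂) * (1 + (pinnedChain ω₂ lam β γ).hamiltonian N x) ^ 1
  rw [pow_one]
  linarith [mul_nonneg h0 hH]

/-- The forces `∂_{q_k}H` are tempered (`LightConeBondHeat.pinnedChain_abs_partialQ_le`). -/
theorem partialQ_hamiltonian (hω : 0 < ω₂) (hl : 0 ≤ lam) (hβ : 0 ≤ β) (k : Fin N) :
    IsTempered ω₂ lam β γ N (partialQ k ((pinnedChain ω₂ lam β γ).hamiltonian N)) :=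
  ⟨N * (ω₂ / 2 + 3 + lam / ω₂ + N ^ 2 * (3 + β)), 1, fun x => by
    rw [pow_one]; exact pinnedChain_abs_partialQ_le hω hl hβ γ N x k⟩

/-- A continuous tempered function is integrable against `e^{-H/T}` (`T > 0`). -/
theorem integrable_mul_gibbsDensity (hF : IsTempered ω₂ lam β γ N F) (hFc : Continuous F)
    (hω : 0 < ω₂) (hl : 0 ≤ lam) (hβ : 0 ≤ β) {T : ℝ} (hT : 0 < T) :
    Integrable fun x => F x * (pinnedChain ω₂ lam β γ).gibbsDensity N T x := by
  obtain ⟨C, m, h⟩ := hF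
  exact pinnedChain_integrable_mul_gibbsDensity_of_le_pow hω hl hβ γ N hT m hFc (C := C) h

end IsTempered

/-! ## B. The pairing rule `∫ (∂_v H) F ρ_T = T ∫ (∂_v F) ρ_T` and its two instances -/

/-- **Gibbs pairing rule, general direction `v`.** If `∂_v H = D` (as a line derivative) with `D`
continuous and tempered, then for every continuous tempered `F` with a continuous tempered line
derivative `F'` along `v`: `∫ D F e^{-H/T} = T ∫ F' e^{-H/T}` — one integration by parts against
`∂_v e^{-H/T} = -(D/T) e^{-H/T}`. -/
theorem integral_lineDeriv_hamiltonian_mul_gibbsDensity_eq (hω : 0 < ω₂) (hl : 0 ≤ lam)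
    (hβ : 0 ≤ β) (γ : ℝ) {T : ℝ} (hT : 0 < T) {v : PhaseSpace N} {D F F' : PhaseSpace N → ℝ}
    (hHd : ∀ x, HasLineDerivAt ℝ ((pinnedChain ω₂ lam β γ).hamiltonian N) (D x) x v)
    (hDc : Continuous D) (hD : IsTempered ω₂ lam β γ N D) (hFc : Continuous F)
    (hF'c : Continuous F') (hFd : ∀ x, HasLineDerivAt ℝ F (F' x) x v)
    (hF : IsTempered ω₂ lam β γ N F) (hF' : IsTempered ω₂ lam β γ N F') :
    ∫ x, D x * F x * (pinnedChain ω₂ lam β γ).gibbsDensity N T x =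
      T * ∫ x, F' x * (pinnedChain ω₂ lam β γ).gibbsDensity N T x := by
  have hF'g : Integrable fun x => F' x * (pinnedChain ω₂ lam β γ).gibbsDensity N T x :=
    hF'.integrable_mul_gibbsDensity hF'c hω hl hβ hT
  have hFg : Integrable fun x => F x * (pinnedChain ω₂ lam β γ).gibbsDensity N T x :=
    hF.integrable_mul_gibbsDensity hFc hω hl hβ hT
  have h2 : Integrable fun x => D x * F x * (pinnedChain ω₂ lam β γ).gibbsDensity N T x :=
    (hD.mul hF).integrable_mul_gibbsDensity (hDc.mul hFc) hω hl hβ hT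
  have hFg' : Integrable fun x => F x *
      (-(D x / T) * (pinnedChain ω₂ lam β γ).gibbsDensity N T x) := by
    refine (h2.const_mul (-T⁻¹)).congr (Filter.Eventually.of_forall fun x => ?_)
    simp only
    ring
  have e := integral_mul_eq_neg_of_hasLineDerivAt_of_integrable (F := F) (F' := F')
    (g := (pinnedChain ω₂ lam β γ).gibbsDensity N T)
    (g' := fun x => -(D x / T) * (pinnedChain ω₂ lam β γ).gibbsDensity N T x) (v := v)
    hF'g hFg' hFg hFd (fun x => (pinnedChain ω₂ lam β γ).hasLineDerivAt_gibbsDensity (hHd x))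
  have lhs : ∫ x, F x * (-(D x / T) * (pinnedChain ω₂ lam β γ).gibbsDensity N T x) =
      -T⁻¹ * ∫ x, D x * F x * (pinnedChain ω₂ lam β γ).gibbsDensity N T x := by
    rw [← integral_const_mul]
    refine integral_congr_ae (Filter.Eventually.of_forall fun x => ?_)
    ring
  rw [lhs] at e
  have hTne : T ≠ 0 := hT.ne'
  have e2 : T⁻¹ * ∫ x, D x * F x * (pinnedChain ω₂ lam β γ).gibbsDensity N T x =
      ∫ x, F' x * (pinnedChain ω₂ lam β γ).gibbsDensity N T x := by linarith
  calc ∫ x, D x * F x * (pinnedChain ω₂ lam β γ).gibbsDensity N T x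
      = T * (T⁻¹ * ∫ x, D x * F x * (pinnedChain ω₂ lam β γ).gibbsDensity N T x) := by
        rw [← mul_assoc, mul_inv_cancel₀ hTne, one_mul]
    _ = T * ∫ x, F' x * (pinnedChain ω₂ lam β γ).gibbsDensity N T x := by rw [e2]

/-- **(IBP-p), line-derivative form** (`v = (0, e_k)`, `∂_v H = p_k`): for `F` continuous and
tempered with a continuous tempered line derivative `F'` along `(0, e_k)`,
`∫ p_k F e^{-H/T} = T ∫ F' e^{-H/T}`. -/
theorem integral_snd_mul_gibbsDensity_eq (hω : 0 < ω₂) (hl : 0 ≤ lam) (hβ : 0 ≤ β) (γ : ℝ)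
    {T : ℝ} (hT : 0 < T) (k : Fin N) {F F' : PhaseSpace N → ℝ} (hFc : Continuous F)
    (hF'c : Continuous F')
    (hFd : ∀ x, HasLineDerivAt ℝ F (F' x) x ((0, Pi.single k 1) : PhaseSpace N))
    (hF : IsTempered ω₂ lam β γ N F) (hF' : IsTempered ω₂ lam β γ N F') :
    ∫ x, x.2 k * F x * (pinnedChain ω₂ lam β γ).gibbsDensity N T x =
      T * ∫ x, F' x * (pinnedChain ω₂ lam β γ).gibbsDensity N T x :=
  integral_lineDeriv_hamiltonian_mul_gibbsDensity_eq hω hl hβ γ hT (D := fun x => x.2 k)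
    (fun x => (pinnedChain ω₂ lam β γ).hasLineDerivAt_hamiltonian_unitP N x k)
    ((continuous_apply k).comp continuous_snd) (IsTempered.snd hω.le hl hβ k) hFc hF'c hFd hF hF'

/-- **(IBP-q), line-derivative form** (`v = (e_k, 0)`, `∂_v H = ∂_{q_k}H`): for `F` continuous and
tempered with a continuous tempered line derivative `F'` along `(e_k, 0)`,
`∫ ∂_{q_k}H F e^{-H/T} = T ∫ F' e^{-H/T}`. -/
theorem integral_partialQ_hamiltonian_mul_gibbsDensity_eq (hω : 0 < ω₂) (hl : 0 ≤ lam)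
    (hβ : 0 ≤ β) (γ : ℝ) {T : ℝ} (hT : 0 < T) (k : Fin N) {F F' : PhaseSpace N → ℝ}
    (hFc : Continuous F) (hF'c : Continuous F')
    (hFd : ∀ x, HasLineDerivAt ℝ F (F' x) x ((Pi.single k 1, 0) : PhaseSpace N))
    (hF : IsTempered ω₂ lam β γ N F) (hF' : IsTempered ω₂ lam β γ N F') :
    ∫ x, partialQ k ((pinnedChain ω₂ lam β γ).hamiltonian N) x * F x *
        (pinnedChain ω₂ lam β γ).gibbsDensity N T x =
      T * ∫ x, F' x * (pinnedChain ω₂ lam β γ).gibbsDensity N T x :=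
  have hH1 : ContDiff ℝ 1 ((pinnedChain ω₂ lam β γ).hamiltonian N) :=
    pinnedChain_contDiff_hamiltonian ω₂ lam β γ N
  integral_lineDeriv_hamiltonian_mul_gibbsDensity_eq hω hl hβ γ hT
    (D := partialQ k ((pinnedChain ω₂ lam β γ).hamiltonian N))
    (fun x => (pinnedChain ω₂ lam β γ).hasLineDerivAt_hamiltonian_unitQ
      (hH1.differentiable one_ne_zero) x k)
    ((pinnedChain ω₂ lam β γ).continuous_partialQ_hamiltonian hH1 k)
    (IsTempered.partialQ_hamiltonian hω hl hβ k) hFc hF'c hFd hF hF'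

/-! ## C. `C¹` forms and Gibbs-measure forms -/

/-- **(IBP-p) for `F ∈ C¹`** with `F, ∂_{p_k}F` tempered: `∫ p_k F e^{-H/T} = T ∫ ∂_{p_k}F e^{-H/T}`. -/
theorem integral_snd_mul_gibbsDensity_eq_partialP (hω : 0 < ω₂) (hl : 0 ≤ lam) (hβ : 0 ≤ β)
    (γ : ℝ) {T : ℝ} (hT : 0 < T) (k : Fin N) {F : PhaseSpace N → ℝ} (hF1 : ContDiff ℝ 1 F)
    (hF : IsTempered ω₂ lam β γ N F) (hF' : IsTempered ω₂ lam β γ N (partialP k F)) :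
    ∫ x, x.2 k * F x * (pinnedChain ω₂ lam β γ).gibbsDensity N T x =
      T * ∫ x, partialP k F x * (pinnedChain ω₂ lam β γ).gibbsDensity N T x :=
  integral_snd_mul_gibbsDensity_eq hω hl hβ γ hT k hF1.continuous
    (continuous_partialP hF1 one_ne_zero k)
    (fun x => hasLineDerivAt_partialP (hF1.differentiable one_ne_zero) k x) hF hF'

/-- **(IBP-q) for `F ∈ C¹`** with `F, ∂_{q_k}F` tempered: `∫ ∂_{q_k}H F e^{-H/T} = T ∫ ∂_{q_k}F e^{-H/T}`. -/
theorem integral_partialQ_hamiltonian_mul_gibbsDensity_eq_partialQ (hω : 0 < ω₂) (hl : 0 ≤ lam)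
    (hβ : 0 ≤ β) (γ : ℝ) {T : ℝ} (hT : 0 < T) (k : Fin N) {F : PhaseSpace N → ℝ}
    (hF1 : ContDiff ℝ 1 F) (hF : IsTempered ω₂ lam β γ N F)
    (hF' : IsTempered ω₂ lam β γ N (partialQ k F)) :
    ∫ x, partialQ k ((pinnedChain ω₂ lam β γ).hamiltonian N) x * F x *
        (pinnedChain ω₂ lam β γ).gibbsDensity N T x =
      T * ∫ x, partialQ k F x * (pinnedChain ω₂ lam β γ).gibbsDensity N T x :=
  integral_partialQ_hamiltonian_mul_gibbsDensity_eq hω hl hβ γ hT k hF1.continuous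
    (continuous_partialQ hF1 one_ne_zero k)
    (fun x => hasLineDerivAt_partialQ (hF1.differentiable one_ne_zero) k x) hF hF'

/-- **The pairing rule under the Gibbs MEASURE `μ_T`:** `∫ D F dμ_T = T ∫ F' dμ_T` whenever
`∂_v H = D` (instances: `D = p_k`, `v = (0, e_k)` via `OscillatorChain.hasLineDerivAt_hamiltonian_unitP`;
`D = ∂_{q_k}H`, `v = (e_k, 0)` via `OscillatorChain.hasLineDerivAt_hamiltonian_unitQ`). -/
theorem integral_lineDeriv_hamiltonian_mul_gibbsMeasure_eq (hω : 0 < ω₂) (hl : 0 ≤ lam)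
    (hβ : 0 ≤ β) (γ : ℝ) {T : ℝ} (hT : 0 < T) {v : PhaseSpace N} {D F F' : PhaseSpace N → ℝ}
    (hHd : ∀ x, HasLineDerivAt ℝ ((pinnedChain ω₂ lam β γ).hamiltonian N) (D x) x v)
    (hDc : Continuous D) (hD : IsTempered ω₂ lam β γ N D) (hFc : Continuous F)
    (hF'c : Continuous F') (hFd : ∀ x, HasLineDerivAt ℝ F (F' x) x v)
    (hF : IsTempered ω₂ lam β γ N F) (hF' : IsTempered ω₂ lam β γ N F') :
    ∫ x, D x * F x ∂(pinnedChain ω₂ lam β γ).gibbsMeasure N T =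
      T * ∫ x, F' x ∂(pinnedChain ω₂ lam β γ).gibbsMeasure N T := by
  rw [OscillatorChain.integral_gibbsMeasure, OscillatorChain.integral_gibbsMeasure,
    integral_lineDeriv_hamiltonian_mul_gibbsDensity_eq hω hl hβ γ hT hHd hDc hD hFc hF'c hFd hF hF']
  ring

/-! ## D. Observables independent of `p_k`; the second-order bath identity -/

/-- Along `(0, e_k)` a function independent of `p_k` has line derivative `0`. -/
theorem hasLineDerivAt_zero_of_indep_snd {F : PhaseSpace N → ℝ} (k : Fin N)
    (hFk : ∀ (x : PhaseSpace N) (t : ℝ), F (x.1, Function.update x.2 k t) = F x)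
    (x : PhaseSpace N) :
    HasLineDerivAt ℝ F 0 x ((0, Pi.single k 1) : PhaseSpace N) := by
  unfold HasLineDerivAt
  have e : ∀ t : ℝ, x + t • ((0, Pi.single k 1) : PhaseSpace N) =
      (x.1, Function.update x.2 k (x.2 k + t)) := fun t => by
    rw [← add_smul_single_eq_update]
    refine Prod.ext ?_ ?_ <;> simp
  have h : (fun t : ℝ => F (x + t • ((0, Pi.single k 1) : PhaseSpace N))) = fun _ => F x := by
    funext t
    rw [e, hFk]
  rw [h]
  exact hasDerivAt_const _ _

/-- Along `(0, e_k)`: `∂_{p_k}(p_k F) = F + p_k ∂_{p_k} F` as a line derivative. -/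
theorem hasLineDerivAt_snd_mul {F : PhaseSpace N → ℝ} {D : ℝ} (k : Fin N) {x : PhaseSpace N}
    (hF : HasLineDerivAt ℝ F D x ((0, Pi.single k 1) : PhaseSpace N)) :
    HasLineDerivAt ℝ (fun y : PhaseSpace N => y.2 k * F y) (F x + x.2 k * D) x
      ((0, Pi.single k 1) : PhaseSpace N) := by
  unfold HasLineDerivAt at *
  have h : (fun t : ℝ => (fun y : PhaseSpace N => y.2 k * F y)
      (x + t • ((0, Pi.single k 1) : PhaseSpace N))) =
      fun t => (x.2 k + t) * F (x + t • ((0, Pi.single k 1) : PhaseSpace N)) := by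
    funext t
    have e2 : (x + t • ((0, Pi.single k 1) : PhaseSpace N)).2 k = x.2 k + t := by
      rw [add_smul_unitP_snd, add_smul_single_eq_update, Function.update_self]
    simp only [e2]
  rw [h]
  have h1 : HasDerivAt (fun t : ℝ => x.2 k + t) 1 0 := (hasDerivAt_id' (0 : ℝ)).const_add _
  refine (h1.mul hF).congr_deriv ?_
  simp

/-- `∫ p_k F e^{-H/T} = 0` for a continuous tempered `F` independent of `p_k`. -/
theorem integral_snd_mul_gibbsDensity_eq_zero (hω : 0 < ω₂) (hl : 0 ≤ lam) (hβ : 0 ≤ β)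
    (γ : ℝ) {T : ℝ} (hT : 0 < T) (k : Fin N) {F : PhaseSpace N → ℝ} (hFc : Continuous F)
    (hF : IsTempered ω₂ lam β γ N F)
    (hFk : ∀ (x : PhaseSpace N) (t : ℝ), F (x.1, Function.update x.2 k t) = F x) :
    ∫ x, x.2 k * F x * (pinnedChain ω₂ lam β γ).gibbsDensity N T x = 0 := by
  have h := integral_snd_mul_gibbsDensity_eq hω hl hβ γ hT k hFc continuous_const
    (fun x => hasLineDerivAt_zero_of_indep_snd k hFk x) hF (IsTempered.const 0)
  simpa using h

/-- `∫ p_k² F e^{-H/T} = T ∫ F e^{-H/T}` for a continuous tempered `F` independent of `p_k`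
(equipartition against a `p_k`-independent weight). -/
theorem integral_snd_sq_mul_gibbsDensity_eq (hω : 0 < ω₂) (hl : 0 ≤ lam) (hβ : 0 ≤ β)
    (γ : ℝ) {T : ℝ} (hT : 0 < T) (k : Fin N) {F : PhaseSpace N → ℝ} (hFc : Continuous F)
    (hF : IsTempered ω₂ lam β γ N F)
    (hFk : ∀ (x : PhaseSpace N) (t : ℝ), F (x.1, Function.update x.2 k t) = F x) :
    ∫ x, x.2 k ^ 2 * F x * (pinnedChain ω₂ lam β γ).gibbsDensity N T x =
      T * ∫ x, F x * (pinnedChain ω₂ lam β γ).gibbsDensity N T x := by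
  have h := integral_snd_mul_gibbsDensity_eq hω hl hβ γ hT k (F := fun y => y.2 k * F y)
    (F' := F) (((continuous_apply k).comp continuous_snd).mul hFc) hFc
    (fun x => by simpa using hasLineDerivAt_snd_mul k (hasLineDerivAt_zero_of_indep_snd k hFk x))
    ((IsTempered.snd hω.le hl hβ k).mul hF) hF
  rw [← h]
  refine integral_congr_ae (Filter.Eventually.of_forall fun x => ?_)
  simp only
  ring

/-- `∫ p_b p_j e^{-H/T} = 0` for `b ≠ j` (the momenta are uncorrelated under the Gibbs weight). -/
theorem integral_snd_mul_snd_gibbsDensity_eq_zero (hω : 0 < ω₂) (hl : 0 ≤ lam) (hβ : 0 ≤ β)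
    (γ : ℝ) {T : ℝ} (hT : 0 < T) {b j : Fin N} (hbj : b ≠ j) :
    ∫ x, x.2 b * x.2 j * (pinnedChain ω₂ lam β γ).gibbsDensity N T x = 0 :=
  integral_snd_mul_gibbsDensity_eq_zero hω hl hβ γ hT b ((continuous_apply j).comp continuous_snd)
    (IsTempered.snd hω.le hl hβ j) fun x t => by
      simp only [Function.update_of_ne hbj.symm]

/-- **Second-order bath identity (Gibbs side of [WL]).** For `F ∈ C²` with `F, ∂_{p_k}F, ∂²_{p_k}F`
tempered: `T² ∫ ∂²_{p_k}F e^{-H/T} = ∫ p_k² F e^{-H/T} - T ∫ F e^{-H/T}`, i.e.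
`⟨∂²_{p_k}F⟩ = ⟨F · (p_k²/T² - 1/T)⟩` (two instances of (IBP-p)). -/
theorem integral_partialP_partialP_mul_gibbsDensity_eq (hω : 0 < ω₂) (hl : 0 ≤ lam) (hβ : 0 ≤ β)
    (γ : ℝ) {T : ℝ} (hT : 0 < T) (k : Fin N) {F : PhaseSpace N → ℝ} (hF2 : ContDiff ℝ 2 F)
    (hF : IsTempered ω₂ lam β γ N F) (hF' : IsTempered ω₂ lam β γ N (partialP k F))
    (hF'' : IsTempered ω₂ lam β γ N (partialP k (partialP k F))) :
    T ^ 2 * ∫ x, partialP k (partialP k F) x * (pinnedChain ω₂ lam β γ).gibbsDensity N T x =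
      (∫ x, x.2 k ^ 2 * F x * (pinnedChain ω₂ lam β γ).gibbsDensity N T x) -
        T * ∫ x, F x * (pinnedChain ω₂ lam β γ).gibbsDensity N T x := by
  have hF1 : ContDiff ℝ 1 F := hF2.of_le (by norm_num)
  have hdF1 : ContDiff ℝ 1 (partialP k F) := contDiff_partialP hF2 (by norm_num) k
  have hFd : Differentiable ℝ F := hF1.differentiable one_ne_zero
  have hFc : Continuous F := hF1.continuous; have hdFc : Continuous (partialP k F) := hdF1.continuous
  -- (1) `∫ p_k ∂_kF ρ = T ∫ ∂_k∂_kF ρ`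
  have e1 := integral_snd_mul_gibbsDensity_eq_partialP hω hl hβ γ hT k hdF1 hF' hF''
  -- (2) `∫ p_k (p_k F) ρ = T ∫ (F + p_k ∂_kF) ρ`
  have e2 := integral_snd_mul_gibbsDensity_eq hω hl hβ γ hT k (F := fun y => y.2 k * F y)
    (F' := fun y => F y + y.2 k * partialP k F y)
    (((continuous_apply k).comp continuous_snd).mul hFc)
    (hFc.add (((continuous_apply k).comp continuous_snd).mul hdFc))
    (fun x => hasLineDerivAt_snd_mul k (hasLineDerivAt_partialP hFd k x))
    ((IsTempered.snd hω.le hl hβ k).mul hF)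
    (hF.add hω.le hl hβ ((IsTempered.snd hω.le hl hβ k).mul hF'))
  have hi1 : Integrable fun x => F x * (pinnedChain ω₂ lam β γ).gibbsDensity N T x :=
    hF.integrable_mul_gibbsDensity hFc hω hl hβ hT
  have hi2 : Integrable fun x => x.2 k * partialP k F x *
      (pinnedChain ω₂ lam β γ).gibbsDensity N T x :=
    ((IsTempered.snd hω.le hl hβ k).mul hF').integrable_mul_gibbsDensity
      (((continuous_apply k).comp continuous_snd).mul hdFc) hω hl hβ hT
  have split : ∫ x, (F x + x.2 k * partialP k F x) * (pinnedChain ω₂ lam β γ).gibbsDensity N T x =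
      (∫ x, F x * (pinnedChain ω₂ lam β γ).gibbsDensity N T x) +
        ∫ x, x.2 k * partialP k F x * (pinnedChain ω₂ lam β γ).gibbsDensity N T x := by
    rw [← integral_add hi1 hi2]
    refine integral_congr_ae (Filter.Eventually.of_forall fun x => ?_)
    ring
  have lhs2 : ∫ x, x.2 k * (x.2 k * F x) * (pinnedChain ω₂ lam β γ).gibbsDensity N T x =
      ∫ x, x.2 k ^ 2 * F x * (pinnedChain ω₂ lam β γ).gibbsDensity N T x := by
    refine integral_congr_ae (Filter.Eventually.of_forall fun x => ?_)
    ring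
  rw [split, lhs2, e1] at e2
  linear_combination -e2

end EscapeGrading

end Summit.AtomisticToContinuum.FouriersLaw.Theorems.SubdiffusiveBondHeat
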